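import Summits.QuantumFields.BalabanUV.Beta.D1BFx.TorusBondArrays

/-!
# TB4-W PART 3b-N (FILE N2) — the first-order STRAIGHT WEIGHT JET `2•wgt₁` as a periodised bond array (road «BF-x», slot (K))

Owner spec K-END-RECUT-SPEC v1 §2 (journal l.25308): the gluon family of the re-cut END carries `ℬ = gram₁(Tjet, Ajet)` = 3a's `2•wgt₁ b`
(`TorusWeightJetsCombFree.gram₁_Tjet`) «as `ℤ⁴` arrays».  Here: for the torus image `b = (σu, κ)` of a `ℤ⁴` bond and any basis `N` of `ker Ŝ`
(3a's hypotheses `hN`, `hNinj` — the road's `N̂` by `TorusGaugeBasisKernel.Nhat_range ∕ Nhat_injective`),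
**`2 • wgt₁ s b N = (arr s (Bw₁ (m+1) a κ u))^`** — the fibrewise periodisation (`FibredPeriodisation.periodiseF`, bond fibre `Fin 4`) of TA2's
array of ONE FIXED `ℤ⁴` bond kernel `Bw₁`, bi-localised at `(u, u)` with ONE rate `dB/8` uniformly in the bond.

THE WORDS (`M₀ = L̂D̂ᵀ`, `Mₛ = Ljet·D̂ᵀ − L̂·Êᵀ`, `Ĉ = perT Cgh` (`KGhostLegJunction`), `Ĉₛ = −Ĉ(L̂²)ₛĈ`; §3 of FILE N1 for the legs):
`Mₛᵀ Ĉ M₀ = −D̂ (Ljet Ĉ L̂) D̂ᵀ − Ê (L̂ Ĉ L̂) D̂ᵀ`, `M₀ᵀ Ĉₛ M₀ = −D̂ (L̂Ĉ (L̂²)ₛ ĈL̂) D̂ᵀ`, `M₀ᵀ Ĉ Mₛ = D̂ (L̂ Ĉ Ljet) D̂ᵀ − D̂ (L̂ Ĉ L̂) Êᵀ`, and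
`Ljet Ĉ L̂ = perT (arr wL)`, `L̂ Ĉ Ljet = perT (arr wR)`, `L̂Ĉ(L̂²)ₛĈL̂ = perT (arr wC)`, `L̂ĈL̂ = perT Rgt`; then FILE N1's `D̂·perT(arr Z)·D̂ᵀ = (arr (dSw Z))^`
and 3b-β FILE 2's pinned words `Ê·R̂·D̂ᵀ = (arr (jetR κ u Rgt))^`, `D̂·R̂·Êᵀ = (arr (jetC κ u Rgt))^`.

CONTENT: §1 [our objects] `wL`, `wR`, `wC`, `Bw₁`; §2 the site-word letters; §3 **`two_smul_wgt₁_eq_hat`**; §4 localisation `∃ C, ∀ κ u, BiLoc (Bw₁ n a κ u) u u C (dB n a / 8)`.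
[folklore] matrix algebra + array calculus over landed names; the definitions assert nothing.  (The mixed word `2•wgtMix` — with its two-`Ê` entries,
whose torus values are periodised scalars — is the subject of FILE N3.)
-/

noncomputable section

namespace Summit.QuantumFields.BalabanUV.Beta.D1BFx.TorusWeightWordArrays

open Matrix
open scoped BigOperators
open Literature.MathematicalPhysics.QuantumFieldTheory.Balaban1983to89
open Literature.MathematicalPhysics.QuantumFieldTheory.Balaban1983to89.Beta
open B12Sec2to5 (l1 l1_nonneg)
open ExpKernelCalculus (MKer BiLoc Decays Zl comp shiftK biLoc_comp_decays)
open AffineAveraging (unitVec)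
open KernelWard (biLoc_add biLoc_sub)
open BalabanStepJetsSucc (biLoc_comp_right decays_comp)
open Summit.QuantumFields.BalabanUV.Beta.TameKernelCalculus (decays_of_le biLoc_of_le)
open Summit.QuantumFields.BalabanUV.Beta.D1BFx.PeriodicArrays (arr toF)
open Summit.QuantumFields.BalabanUV.Beta.D1BFx.FibredPeriodisation (periodiseF)
open Summit.QuantumFields.BalabanUV.Beta.D1BFx.GhostStencil (ghCur biLoc_ghCur)
open Summit.QuantumFields.BalabanUV.Beta.D1BFx.RProjector (cPP deltaPP deltaPP_pos)
open Summit.QuantumFields.BalabanUV.Beta.D1BFx.RJetProjector (Rgt decays_Rgt shiftK_Rgt)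
open Summit.QuantumFields.BalabanUV.Beta.D1BFx.RJetAssembly (dSw biLoc_dSw)
open Summit.QuantumFields.BalabanUV.Beta.D1BFx.PeriodisedProjector (Lhat Shat)
open Summit.QuantumFields.BalabanUV.Beta.D1BFx.TorusHodgeWeight (Dhat)
open Summit.QuantumFields.BalabanUV.Beta.D1BFx.TorusGaugeWeight (Lhat_transpose)
open Summit.QuantumFields.BalabanUV.Beta.D1BFx.TorusCoframeJets (Djet Ljet Mjet₀ Mjet₁ transpose_Ljet)
open Summit.QuantumFields.BalabanUV.Beta.D1BFx.TorusWeightJetsCombFree (Chat Cjet₁ Lsq₁ wgt₁)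
open Summit.QuantumFields.BalabanUV.Beta.D1BFx.TorusJetSandwichArrays (jetR jetC biLoc_jetR biLoc_jetC Djet_mul_Yhat_mul_Dhat_transpose
  Dhat_mul_Yhat_mul_Djet_transpose)
open Summit.QuantumFields.BalabanUV.Beta.D1BFx.TorusGhostWordArrays (perT lapU decays_lapU Lgh biLoc_Lgh cL Ljet_eq_perT Lsq_word_eq_perT perT_mul_perT_arr
  perT_arr_mul_perT)
open Summit.QuantumFields.BalabanUV.Beta.D1BFx.KGhostLeg (Cgh deltaCgh deltaCgh_pos decays_Cgh)
open Summit.QuantumFields.BalabanUV.Beta.D1BFx.TorusBondArrays (hat_arr_add hat_arr_sub hat_arr_neg hat_arr_smul Dhat_mul_perT_arr_mul_Dhat_transpose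
  perT_eq_periodise₂ dB dB_pos dB_le_one dB_le_deltaCgh decays_lapU_Cgh decays_Cgh_lapU lapU_Cgh_imageShift Cgh_lapU_imageShift
  Lhat_Chat_Lhat_eq_perT Lhat_mul_perT_Cgh perT_Cgh_mul_Lhat)
open Summit.QuantumFields.BalabanUV.Beta.D1BFx.KGhostLegJunction (Chat_eq_submatrix_periodiseF_Cgh)

/-! ## §1 The `ℤ⁴` words -/

section Words

variable (n : ℕ) [NeZero n] (a : ℝ) (κ : Fin 4) (u : Fin 4 → ℤ)

/-- [our object] `wL := ghCur ∘ (Cgh ∘ lapU)` — the table of `Ljet_b·Ĉ·L̂`. A definition. -/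
def wL : MKer 4 Unit := comp (ghCur κ u) (comp (Cgh n a) lapU)

/-- [our object] `wR := (lapU ∘ Cgh) ∘ ghCur` — the table of `L̂·Ĉ·Ljet_b`. A definition. -/
def wR : MKer 4 Unit := comp (comp lapU (Cgh n a)) (ghCur κ u)

/-- [our object] `wC := ((lapU ∘ Cgh) ∘ Lgh) ∘ (Cgh ∘ lapU)` — the table of `L̂Ĉ·(L̂²)_b·ĈL̂`. A definition. -/
def wC : MKer 4 Unit := comp (comp (comp lapU (Cgh n a)) (Lgh κ u)) (comp (Cgh n a) lapU)

/-- [our object] **THE BOND TABLE OF `2•wgt₁`**: `Bw₁ := 2•(−dSw wL − jetR κ u Rgt − dSw wC + dSw wR − jetC κ u Rgt)`. A definition; asserts nothing. -/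
def Bw₁ : MKer 4 (Fin 4) :=
  (2 : ℝ) • (-dSw (wL n a κ u) - jetR κ u (Rgt n a) - dSw (wC n a κ u) + dSw (wR n a κ u) - jetC κ u (Rgt n a))

end Words

/-! ## §2 The site-word letters on the torus `Site 4 ((m+1)·p)` -/

section Letters

variable (m : ℕ) {a : ℝ} (p : ℕ) [NeZero p] {ρ : Type*} [Fintype ρ] [DecidableEq ρ] (κ : Fin 4) (u : Fin 4 → ℤ)

/-- [folklore] **`Ljet_b · (perT Cgh · L̂) = perT (arr wL)`**. -/
theorem Ljet_Cgh_Lhat (ha : 0 < a) :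
    Ljet ((m + 1) * p) (siteOf 4 ((m + 1) * p) u, κ) * (perT ((m + 1) * p) (Cgh (m + 1) a) * Lhat ((m + 1) * p))
      = perT ((m + 1) * p) (arr ((m + 1) * p) (wL (m + 1) a κ u)) := by
  obtain ⟨C, hC⟩ := decays_Cgh_lapU (m + 1) a ha
  rw [perT_Cgh_mul_Lhat a m p ha, Ljet_eq_perT,
    perT_arr_mul_perT _ hC (half_pos (dB_pos (m + 1) a ha)) (Cgh_lapU_imageShift (m + 1) a ha p) (biLoc_ghCur κ u 1) one_pos, wL]

/-- [folklore] **`(L̂ · perT Cgh) · Ljet_b = perT (arr wR)`**. -/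
theorem Lhat_Cgh_Ljet (ha : 0 < a) :
    Lhat ((m + 1) * p) * perT ((m + 1) * p) (Cgh (m + 1) a) * Ljet ((m + 1) * p) (siteOf 4 ((m + 1) * p) u, κ)
      = perT ((m + 1) * p) (arr ((m + 1) * p) (wR (m + 1) a κ u)) := by
  obtain ⟨C, hC⟩ := decays_lapU_Cgh (m + 1) a ha
  rw [Lhat_mul_perT_Cgh a m p ha, Ljet_eq_perT,
    perT_mul_perT_arr _ hC (half_pos (dB_pos (m + 1) a ha)) (lapU_Cgh_imageShift (m + 1) a ha p) (biLoc_ghCur κ u 1) one_pos, wR]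

/-- [folklore] `BiLoc ((lapU ∘ Cgh) ∘ Lgh_b) u u C (dB/4)` uniformly in the bond (the inner word of `wC`). -/
theorem biLoc_lapU_Cgh_Lgh (ha : 0 < a) :
    ∃ C : ℝ, 0 ≤ C ∧ ∀ (κ : Fin 4) (u : Fin 4 → ℤ), BiLoc (comp (comp lapU (Cgh (m + 1) a)) (Lgh κ u)) u u C (dB (m + 1) a / 4) := by
  obtain ⟨C, hC⟩ := decays_lapU_Cgh (m + 1) a ha
  have hd := dB_pos (m + 1) a ha
  have hL : ∀ (κ : Fin 4) (u : Fin 4 → ℤ), BiLoc (Lgh κ u) u u cL (dB (m + 1) a / 2) :=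
    fun κ u => StepJetData.biLoc_weaken (biLoc_Lgh κ u) le_rfl (by linarith [dB_le_one (m + 1) a])
  refine ⟨_, ?_, fun κ u => biLoc_comp_decays hC (hL κ u) (by linarith) (by linarith : dB (m + 1) a / 4 < dB (m + 1) a / 2)⟩
  exact mul_nonneg (mul_nonneg (Nat.cast_nonneg _) (mul_nonneg (hC.nonneg ()) ((hL 0 0).nonneg ()))) (ExpKernelCalculus.Zl_pos (by linarith)).le

/-- [folklore] **`(L̂·perT Cgh) · (Ljet_b L̂ + L̂ Ljet_b) · (perT Cgh·L̂) = perT (arr wC)`**. -/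
theorem Lhat_Cgh_Lsq_Cgh_Lhat (ha : 0 < a) :
    Lhat ((m + 1) * p) * perT ((m + 1) * p) (Cgh (m + 1) a)
        * (Ljet ((m + 1) * p) (siteOf 4 ((m + 1) * p) u, κ) * Lhat ((m + 1) * p)
            + Lhat ((m + 1) * p) * Ljet ((m + 1) * p) (siteOf 4 ((m + 1) * p) u, κ))
        * (perT ((m + 1) * p) (Cgh (m + 1) a) * Lhat ((m + 1) * p))
      = perT ((m + 1) * p) (arr ((m + 1) * p) (wC (m + 1) a κ u)) := by
  obtain ⟨C₁, hC₁⟩ := decays_lapU_Cgh (m + 1) a ha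
  obtain ⟨C₂, hC₂⟩ := decays_Cgh_lapU (m + 1) a ha
  obtain ⟨C₃, -, hC₃⟩ := biLoc_lapU_Cgh_Lgh m ha
  have hd := dB_pos (m + 1) a ha
  rw [Lhat_mul_perT_Cgh a m p ha, perT_Cgh_mul_Lhat a m p ha, Lsq_word_eq_perT,
    perT_mul_perT_arr _ hC₁ (half_pos hd) (lapU_Cgh_imageShift (m + 1) a ha p) (biLoc_Lgh κ u) (by norm_num),
    perT_arr_mul_perT _ hC₂ (half_pos hd) (Cgh_lapU_imageShift (m + 1) a ha p) (hC₃ κ u) (by linarith), wC]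

omit [NeZero p] in
/-- [folklore] `Rgt` is invariant under the translations `((m+1)·p)·t`. -/
theorem shiftK_Rgt_mul (ha : 0 < a) (t : Fin 4 → ℤ) : shiftK ((((m + 1) * p : ℕ) : ℤ) • t) (Rgt (m + 1) a) = Rgt (m + 1) a := by
  rw [Nat.cast_mul, mul_smul]
  exact_mod_cast shiftK_Rgt (m + 1) ha ((p : ℤ) • t)

/-- [folklore] **`Ê_b · (L̂ĈL̂) · D̂ᵀ = (arr (jetR κ u Rgt))^`** (FILE N1 `Lhat_Chat_Lhat_eq_perT` + 3b-β FILE 2). -/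
theorem Djet_Rhat_Dhat_transpose (ha : 0 < a) {N : Matrix (Site 4 ((m + 1) * p)) ρ ℝ}
    (hN : ∀ lam : Site 4 ((m + 1) * p) → ℝ, Shat m ((m + 1) * p) *ᵥ lam = 0 ↔ ∃ c : ρ → ℝ, lam = N *ᵥ c)
    (hNinj : Function.Injective N.mulVec) :
    Djet ((m + 1) * p) (siteOf 4 ((m + 1) * p) u, κ) * (Lhat ((m + 1) * p) * Chat ((m + 1) * p) N * Lhat ((m + 1) * p))
        * (Dhat 4 ((m + 1) * p))ᵀ
      = Matrix.of (periodiseF ((m + 1) * p) (toF (arr ((m + 1) * p) (jetR κ u (Rgt (m + 1) a))))) := by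
  rw [Lhat_Chat_Lhat_eq_perT a m p ha hN hNinj, perT_eq_periodise₂]
  exact Djet_mul_Yhat_mul_Dhat_transpose _ κ u (decays_Rgt (m + 1) a ha)
    (div_pos (deltaPP_pos 4 ha) (mul_pos four_pos (Nat.cast_pos.mpr (Nat.succ_pos m)))) (shiftK_Rgt_mul m p ha)

/-- [folklore] **`D̂ · (L̂ĈL̂) · Ê_bᵀ = (arr (jetC κ u Rgt))^`**. -/
theorem Dhat_Rhat_Djet_transpose (ha : 0 < a) {N : Matrix (Site 4 ((m + 1) * p)) ρ ℝ}
    (hN : ∀ lam : Site 4 ((m + 1) * p) → ℝ, Shat m ((m + 1) * p) *ᵥ lam = 0 ↔ ∃ c : ρ → ℝ, lam = N *ᵥ c)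
    (hNinj : Function.Injective N.mulVec) :
    Dhat 4 ((m + 1) * p) * (Lhat ((m + 1) * p) * Chat ((m + 1) * p) N * Lhat ((m + 1) * p))
        * (Djet ((m + 1) * p) (siteOf 4 ((m + 1) * p) u, κ))ᵀ
      = Matrix.of (periodiseF ((m + 1) * p) (toF (arr ((m + 1) * p) (jetC κ u (Rgt (m + 1) a))))) := by
  rw [Lhat_Chat_Lhat_eq_perT a m p ha hN hNinj, perT_eq_periodise₂]
  exact Dhat_mul_Yhat_mul_Djet_transpose _ κ u (decays_Rgt (m + 1) a ha)
    (div_pos (deltaPP_pos 4 ha) (mul_pos four_pos (Nat.cast_pos.mpr (Nat.succ_pos m)))) (shiftK_Rgt_mul m p ha)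

end Letters

/-! ## §3 Localisation of the words (one rate `dB/8`, constants uniform in the bond) -/

section Loc

variable (m : ℕ) {a : ℝ} (p : ℕ) [NeZero p]

/-- [folklore] `BiLoc (dSw wL) u u C (dB/8)` uniformly in the bond. -/
theorem biLoc_dSw_wL (ha : 0 < a) :
    ∃ C : ℝ, 0 ≤ C ∧ ∀ (κ : Fin 4) (u : Fin 4 → ℤ), BiLoc (dSw (wL (m + 1) a κ u)) u u C (dB (m + 1) a / 8) := by
  obtain ⟨C, hC⟩ := decays_Cgh_lapU (m + 1) a ha
  have hd := dB_pos (m + 1) a ha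
  have hw : ∀ (κ : Fin 4) (u : Fin 4 → ℤ), BiLoc (wL (m + 1) a κ u) u u
      ((Fintype.card Unit : ℝ) * (Real.exp (dB (m + 1) a / 2) * C) * Zl 4 (dB (m + 1) a / 2 - dB (m + 1) a / 4)) (dB (m + 1) a / 4) :=
    fun κ u => biLoc_comp_right (biLoc_ghCur κ u (dB (m + 1) a / 2)) hC (by linarith) (by linarith)
  have h0 : 0 ≤ (Fintype.card Unit : ℝ) * (Real.exp (dB (m + 1) a / 2) * C) * Zl 4 (dB (m + 1) a / 2 - dB (m + 1) a / 4) :=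
    mul_nonneg (mul_nonneg (Nat.cast_nonneg _) (mul_nonneg (Real.exp_pos _).le (hC.nonneg ()))) (ExpKernelCalculus.Zl_pos (by linarith)).le
  refine ⟨4 * ((Fintype.card Unit : ℝ) * (Real.exp (dB (m + 1) a / 2) * C) * Zl 4 (dB (m + 1) a / 2 - dB (m + 1) a / 4))
      * Real.exp (2 * (dB (m + 1) a / 4)), mul_nonneg (mul_nonneg (by norm_num) h0) (Real.exp_pos _).le, fun κ u => ?_⟩
  exact StepJetData.biLoc_weaken (biLoc_dSw u _ (by linarith) (hw κ u)) le_rfl (by linarith)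

/-- [folklore] `BiLoc (dSw wR) u u C (dB/8)` uniformly in the bond. -/
theorem biLoc_dSw_wR (ha : 0 < a) :
    ∃ C : ℝ, 0 ≤ C ∧ ∀ (κ : Fin 4) (u : Fin 4 → ℤ), BiLoc (dSw (wR (m + 1) a κ u)) u u C (dB (m + 1) a / 8) := by
  obtain ⟨C, hC⟩ := decays_lapU_Cgh (m + 1) a ha
  have hd := dB_pos (m + 1) a ha
  have hw : ∀ (κ : Fin 4) (u : Fin 4 → ℤ), BiLoc (wR (m + 1) a κ u) u u
      ((Fintype.card Unit : ℝ) * (C * Real.exp (dB (m + 1) a / 2)) * Zl 4 (dB (m + 1) a / 2 - dB (m + 1) a / 4)) (dB (m + 1) a / 4) :=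
    fun κ u => biLoc_comp_decays hC (biLoc_ghCur κ u (dB (m + 1) a / 2)) (by linarith) (by linarith)
  have h0 : 0 ≤ (Fintype.card Unit : ℝ) * (C * Real.exp (dB (m + 1) a / 2)) * Zl 4 (dB (m + 1) a / 2 - dB (m + 1) a / 4) :=
    mul_nonneg (mul_nonneg (Nat.cast_nonneg _) (mul_nonneg (hC.nonneg ()) (Real.exp_pos _).le)) (ExpKernelCalculus.Zl_pos (by linarith)).le
  refine ⟨4 * ((Fintype.card Unit : ℝ) * (C * Real.exp (dB (m + 1) a / 2)) * Zl 4 (dB (m + 1) a / 2 - dB (m + 1) a / 4))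
      * Real.exp (2 * (dB (m + 1) a / 4)), mul_nonneg (mul_nonneg (by norm_num) h0) (Real.exp_pos _).le, fun κ u => ?_⟩
  exact StepJetData.biLoc_weaken (biLoc_dSw u _ (by linarith) (hw κ u)) le_rfl (by linarith)

/-- [folklore] `BiLoc (dSw wC) u u C (dB/8)` uniformly in the bond. -/
theorem biLoc_dSw_wC (ha : 0 < a) :
    ∃ C : ℝ, 0 ≤ C ∧ ∀ (κ : Fin 4) (u : Fin 4 → ℤ), BiLoc (dSw (wC (m + 1) a κ u)) u u C (dB (m + 1) a / 8) := by
  obtain ⟨C₂, hC₂⟩ := decays_Cgh_lapU (m + 1) a ha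
  obtain ⟨C₃, h3, hC₃⟩ := biLoc_lapU_Cgh_Lgh m ha
  have hd := dB_pos (m + 1) a ha
  have hC₂' : Decays (comp (Cgh (m + 1) a) lapU) (|C₂|) (dB (m + 1) a / 4) := decays_of_le hC₂ (by linarith)
  have hw : ∀ (κ : Fin 4) (u : Fin 4 → ℤ), BiLoc (wC (m + 1) a κ u) u u
      ((Fintype.card Unit : ℝ) * (C₃ * |C₂|) * Zl 4 (dB (m + 1) a / 4 - dB (m + 1) a / 8)) (dB (m + 1) a / 8) :=
    fun κ u => biLoc_comp_right (hC₃ κ u) hC₂' (by linarith) (by linarith)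
  have h0 : 0 ≤ (Fintype.card Unit : ℝ) * (C₃ * |C₂|) * Zl 4 (dB (m + 1) a / 4 - dB (m + 1) a / 8) :=
    mul_nonneg (mul_nonneg (Nat.cast_nonneg _) (mul_nonneg h3 (abs_nonneg _))) (ExpKernelCalculus.Zl_pos (by linarith)).le
  exact ⟨4 * ((Fintype.card Unit : ℝ) * (C₃ * |C₂|) * Zl 4 (dB (m + 1) a / 4 - dB (m + 1) a / 8)) * Real.exp (2 * (dB (m + 1) a / 8)),
    mul_nonneg (mul_nonneg (by norm_num) h0) (Real.exp_pos _).le, fun κ u => biLoc_dSw u _ (by linarith) (hw κ u)⟩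

/-- [folklore] `dB/8` is below the rate of `Rgt` (`dB ≤ deltaCgh ≤ (deltaPP∕4(m+1))∕4`). -/
theorem dB_le_rate_Rgt (ha : 0 < a) : dB (m + 1) a / 8 ≤ deltaPP 4 a / (4 * ((m + 1 : ℕ) : ℝ)) := by
  have h1 := dB_le_deltaCgh (m + 1) a
  have h2 : deltaCgh (m + 1) a ≤ deltaPP 4 a / (4 * ((m + 1 : ℕ) : ℝ)) / 4 := by
    unfold deltaCgh; exact div_le_div_of_nonneg_right (min_le_right _ _) (by norm_num)
  have h3 : 0 ≤ deltaPP 4 a / (4 * ((m + 1 : ℕ) : ℝ)) :=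
    (div_pos (deltaPP_pos 4 ha) (mul_pos four_pos (Nat.cast_pos.mpr (Nat.succ_pos m)))).le
  have hd := dB_pos (m + 1) a ha
  linarith

/-- [folklore] `Rgt (m+1) a` decays at the rate `dB/8`. -/
theorem decays_Rgt_dB (ha : 0 < a) :
    Decays (Rgt (m + 1) a) (|1 + cPP 4 (m + 1 - 1) a * Real.exp (deltaPP 4 a)|) (dB (m + 1) a / 8) :=
  decays_of_le (decays_Rgt (m + 1) a ha) (dB_le_rate_Rgt m ha)

/-- [folklore] `BiLoc (jetR κ u Rgt) u u C (dB/8)` and `BiLoc (jetC κ u Rgt) u u C (dB/8)` uniformly in the bond. -/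
theorem biLoc_jetR_jetC (ha : 0 < a) :
    ∃ C : ℝ, 0 ≤ C ∧ ∀ (κ : Fin 4) (u : Fin 4 → ℤ),
      BiLoc (jetR κ u (Rgt (m + 1) a)) u u C (dB (m + 1) a / 8) ∧ BiLoc (jetC κ u (Rgt (m + 1) a)) u u C (dB (m + 1) a / 8) := by
  have hd := dB_pos (m + 1) a ha
  refine ⟨2 * |1 + cPP 4 (m + 1 - 1) a * Real.exp (deltaPP 4 a)| * Real.exp (2 * (dB (m + 1) a / 8)), by positivity, fun κ u => ⟨?_, ?_⟩⟩
  · exact biLoc_jetR κ u (hδ := by linarith) (hY := decays_Rgt_dB m ha)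
  · exact biLoc_jetC κ u (hδ := by linarith) (hY := decays_Rgt_dB m ha)

/-- [folklore] **LOCALISATION SOCKET OF `Bw₁`**: ONE constant and ONE rate `dB/8` for every bond — the `hV`-letter of the N-side sockets
(`KLimitGluon` ∕ `SortedTraces.tendsto_hessT_sortK_hessKer`, after the sorted re-indexing of the bond fibre). -/
theorem biLoc_Bw₁ (ha : 0 < a) : ∃ C : ℝ, ∀ (κ : Fin 4) (u : Fin 4 → ℤ), BiLoc (Bw₁ (m + 1) a κ u) u u C (dB (m + 1) a / 8) := by
  obtain ⟨C₁, -, h₁⟩ := biLoc_dSw_wL m ha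
  obtain ⟨C₂, -, h₂⟩ := biLoc_jetR_jetC m ha
  obtain ⟨C₃, -, h₃⟩ := biLoc_dSw_wC m ha
  obtain ⟨C₄, -, h₄⟩ := biLoc_dSw_wR m ha
  refine ⟨|(2 : ℝ)| * (C₁ + C₂ + C₃ + C₄ + C₂), fun κ u => ?_⟩
  rw [Bw₁]
  exact StepJetData.biLoc_smul
    (biLoc_sub (biLoc_add (biLoc_sub (biLoc_sub (SecondOrderResponse.biLoc_neg (h₁ κ u)) (h₂ κ u).1) (h₃ κ u)) (h₄ κ u)) (h₂ κ u).2) 2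

end Loc

/-! ## §4 The first weight jet as one bond array -/

section Assembly

variable (m : ℕ) {a : ℝ} (p : ℕ) [NeZero p] {ρ : Type*} [Fintype ρ] [DecidableEq ρ] (κ : Fin 4) (u : Fin 4 → ℤ)

/-- [folklore] **`2•wgt₁ = (arr Bw₁)^`**: twice the first straight weight jet of 3a at the torus bond `(σu, κ)`, over any basis `N` of `ker Ŝ`,
is the bond-fibred periodisation of TA2's array of the fixed `ℤ⁴` kernel `Bw₁ (m+1) a κ u`. -/
theorem two_smul_wgt₁_eq_hat (ha : 0 < a) {N : Matrix (Site 4 ((m + 1) * p)) ρ ℝ}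
    (hN : ∀ lam : Site 4 ((m + 1) * p) → ℝ, Shat m ((m + 1) * p) *ᵥ lam = 0 ↔ ∃ c : ρ → ℝ, lam = N *ᵥ c)
    (hNinj : Function.Injective N.mulVec) :
    (2 : ℝ) • wgt₁ ((m + 1) * p) (siteOf 4 ((m + 1) * p) u, κ) N
      = Matrix.of (periodiseF ((m + 1) * p) (toF (arr ((m + 1) * p) (Bw₁ (m + 1) a κ u)))) := by
  have hd := dB_pos (m + 1) a ha
  have hd8 : 0 < dB (m + 1) a / 8 := by linarith
  obtain ⟨C₁, -, h₁⟩ := biLoc_dSw_wL m ha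
  obtain ⟨C₂, -, h₂⟩ := biLoc_jetR_jetC m ha
  obtain ⟨C₃, -, h₃⟩ := biLoc_dSw_wC m ha
  obtain ⟨C₄, -, h₄⟩ := biLoc_dSw_wR m ha
  obtain ⟨CL, -, hL⟩ := (show ∃ C : ℝ, 0 ≤ C ∧ ∀ (κ : Fin 4) (u : Fin 4 → ℤ), BiLoc (wL (m + 1) a κ u) u u C (dB (m + 1) a / 4) from by
    obtain ⟨C, hC⟩ := decays_Cgh_lapU (m + 1) a ha
    exact ⟨_, mul_nonneg (mul_nonneg (Nat.cast_nonneg _) (mul_nonneg (Real.exp_pos _).le (hC.nonneg ()))) (ExpKernelCalculus.Zl_pos (by linarith)).le,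
      fun κ u => biLoc_comp_right (biLoc_ghCur κ u (dB (m + 1) a / 2)) hC (by linarith) (by linarith : dB (m + 1) a / 4 < dB (m + 1) a / 2)⟩)
  obtain ⟨CR, -, hR⟩ := (show ∃ C : ℝ, 0 ≤ C ∧ ∀ (κ : Fin 4) (u : Fin 4 → ℤ), BiLoc (wR (m + 1) a κ u) u u C (dB (m + 1) a / 4) from by
    obtain ⟨C, hC⟩ := decays_lapU_Cgh (m + 1) a ha
    exact ⟨_, mul_nonneg (mul_nonneg (Nat.cast_nonneg _) (mul_nonneg (hC.nonneg ()) (Real.exp_pos _).le)) (ExpKernelCalculus.Zl_pos (by linarith)).le,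
      fun κ u => biLoc_comp_decays hC (biLoc_ghCur κ u (dB (m + 1) a / 2)) (by linarith) (by linarith : dB (m + 1) a / 4 < dB (m + 1) a / 2)⟩)
  obtain ⟨CC, -, hC'⟩ := (show ∃ C : ℝ, 0 ≤ C ∧ ∀ (κ : Fin 4) (u : Fin 4 → ℤ), BiLoc (wC (m + 1) a κ u) u u C (dB (m + 1) a / 8) from by
    obtain ⟨C₂', hC₂⟩ := decays_Cgh_lapU (m + 1) a ha
    obtain ⟨C₃', h3, hC₃⟩ := biLoc_lapU_Cgh_Lgh m ha
    have hC₂'' : Decays (comp (Cgh (m + 1) a) lapU) (|C₂'|) (dB (m + 1) a / 4) := decays_of_le hC₂ (by linarith)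
    exact ⟨_, mul_nonneg (mul_nonneg (Nat.cast_nonneg _) (mul_nonneg h3 (abs_nonneg _))) (ExpKernelCalculus.Zl_pos (by linarith)).le,
      fun κ u => biLoc_comp_right (hC₃ κ u) hC₂'' (by linarith) (by linarith : dB (m + 1) a / 8 < dB (m + 1) a / 4)⟩)
  have hCh : Chat ((m + 1) * p) N = perT ((m + 1) * p) (Cgh (m + 1) a) := Chat_eq_submatrix_periodiseF_Cgh m p ha hN hNinj
  -- the three terms of `wgt₁`
  have hTb : (Mjet₁ ((m + 1) * p) (siteOf 4 ((m + 1) * p) u, κ))ᵀ * Chat ((m + 1) * p) N * Mjet₀ ((m + 1) * p)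
      = -Matrix.of (periodiseF ((m + 1) * p) (toF (arr ((m + 1) * p) (dSw (wL (m + 1) a κ u)))))
          - Matrix.of (periodiseF ((m + 1) * p) (toF (arr ((m + 1) * p) (jetR κ u (Rgt (m + 1) a))))) := by
    have e1 : (Mjet₁ ((m + 1) * p) (siteOf 4 ((m + 1) * p) u, κ))ᵀ * Chat ((m + 1) * p) N * Mjet₀ ((m + 1) * p)
        = -(Dhat 4 ((m + 1) * p) * (Ljet ((m + 1) * p) (siteOf 4 ((m + 1) * p) u, κ) * (Chat ((m + 1) * p) N * Lhat ((m + 1) * p))) * (Dhat 4 ((m + 1) * p))ᵀ)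
            - Djet ((m + 1) * p) (siteOf 4 ((m + 1) * p) u, κ) * (Lhat ((m + 1) * p) * Chat ((m + 1) * p) N * Lhat ((m + 1) * p)) * (Dhat 4 ((m + 1) * p))ᵀ := by
      rw [Mjet₁, Mjet₀, Matrix.transpose_sub, Matrix.transpose_mul, Matrix.transpose_mul, Matrix.transpose_transpose,
        Matrix.transpose_transpose, transpose_Ljet, Lhat_transpose]
      simp only [Matrix.sub_mul, Matrix.neg_mul, Matrix.mul_neg, Matrix.mul_assoc]
    rw [e1, Djet_Rhat_Dhat_transpose m p κ u ha hN hNinj, hCh, Ljet_Cgh_Lhat m p κ u ha,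
      Dhat_mul_perT_arr_mul_Dhat_transpose _ (hL κ u) (by linarith)]
  have hTc : (Mjet₀ ((m + 1) * p))ᵀ * Cjet₁ ((m + 1) * p) (siteOf 4 ((m + 1) * p) u, κ) N * Mjet₀ ((m + 1) * p)
      = -Matrix.of (periodiseF ((m + 1) * p) (toF (arr ((m + 1) * p) (dSw (wC (m + 1) a κ u))))) := by
    have e1 : (Mjet₀ ((m + 1) * p))ᵀ * Cjet₁ ((m + 1) * p) (siteOf 4 ((m + 1) * p) u, κ) N * Mjet₀ ((m + 1) * p)
        = -(Dhat 4 ((m + 1) * p) * (Lhat ((m + 1) * p) * Chat ((m + 1) * p) N * (Ljet ((m + 1) * p) (siteOf 4 ((m + 1) * p) u, κ) * Lhat ((m + 1) * p) + Lhat ((m + 1) * p) * Ljet ((m + 1) * p) (siteOf 4 ((m + 1) * p) u, κ))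
            * (Chat ((m + 1) * p) N * Lhat ((m + 1) * p))) * (Dhat 4 ((m + 1) * p))ᵀ) := by
      rw [Cjet₁, Lsq₁, Mjet₀, Matrix.transpose_mul, Matrix.transpose_transpose, Lhat_transpose]
      simp only [Matrix.mul_neg, Matrix.neg_mul, Matrix.mul_assoc]
    rw [e1, hCh, Lhat_Cgh_Lsq_Cgh_Lhat m p κ u ha, Dhat_mul_perT_arr_mul_Dhat_transpose _ (hC' κ u) hd8]
  have hTa : (Mjet₀ ((m + 1) * p))ᵀ * Chat ((m + 1) * p) N * Mjet₁ ((m + 1) * p) (siteOf 4 ((m + 1) * p) u, κ)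
      = Matrix.of (periodiseF ((m + 1) * p) (toF (arr ((m + 1) * p) (dSw (wR (m + 1) a κ u)))))
          - Matrix.of (periodiseF ((m + 1) * p) (toF (arr ((m + 1) * p) (jetC κ u (Rgt (m + 1) a))))) := by
    have e1 : (Mjet₀ ((m + 1) * p))ᵀ * Chat ((m + 1) * p) N * Mjet₁ ((m + 1) * p) (siteOf 4 ((m + 1) * p) u, κ)
        = Dhat 4 ((m + 1) * p) * (Lhat ((m + 1) * p) * Chat ((m + 1) * p) N * Ljet ((m + 1) * p) (siteOf 4 ((m + 1) * p) u, κ)) * (Dhat 4 ((m + 1) * p))ᵀ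
            - Dhat 4 ((m + 1) * p) * (Lhat ((m + 1) * p) * Chat ((m + 1) * p) N * Lhat ((m + 1) * p)) * (Djet ((m + 1) * p) (siteOf 4 ((m + 1) * p) u, κ))ᵀ := by
      rw [Mjet₁, Mjet₀, Matrix.transpose_mul, Matrix.transpose_transpose, Lhat_transpose]
      simp only [Matrix.mul_sub, Matrix.mul_assoc]
    rw [e1, Dhat_Rhat_Djet_transpose m p κ u ha hN hNinj, hCh, Lhat_Cgh_Ljet m p κ u ha,
      Dhat_mul_perT_arr_mul_Dhat_transpose _ (hR κ u) (by linarith)]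
  -- assemble
  have hE1 : BiLoc (-dSw (wL (m + 1) a κ u)) u u C₁ (dB (m + 1) a / 8) := SecondOrderResponse.biLoc_neg (h₁ κ u)
  have hE2 := biLoc_sub hE1 (h₂ κ u).1
  have hE3 := biLoc_sub hE2 (h₃ κ u)
  have hE4 := biLoc_add hE3 (h₄ κ u)
  rw [wgt₁, hTb, hTc, hTa, Bw₁, hat_arr_smul, hat_arr_sub _ hE4 hd8 (h₂ κ u).2 hd8, hat_arr_add _ hE3 hd8 (h₄ κ u) hd8,
    hat_arr_sub _ hE2 hd8 (h₃ κ u) hd8, hat_arr_sub _ hE1 hd8 (h₂ κ u).1 hd8, hat_arr_neg]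
  simp only [smul_add, smul_sub, smul_neg]
  abel

end Assembly

end Summit.QuantumFields.BalabanUV.Beta.D1BFx.TorusWeightWordArrays

end
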